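import Summits.QuantumAdvantage.QuantumAdvantage.Theorems.CharDialPartyDialB1

/-!
# PartyDial (decomp-qadv lens-5 g35), part B2 — §1b: full derandomisation, counting the LOSE set of a table profile, the pattern law

See part A (`CharDialPartyDialA`) for the node header; memo `NODE-g35.md` (g35 folder of decomp-qadv-lens-5).
-/

set_option autoImplicit false
set_option linter.dupNamespace false

namespace Summit.QuantumAdvantage.QuantumAdvantage.Theorems.PartyDial

open Finset
open Summit.QuantumAdvantage.AdviceFreeQNC0

section Bridge

variable {n : ℕ} {bl : Fin n → ℕ}

/-- **Full derandomisation**: the first `m ≤ k` parties play class-tables. -/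
theorem derand (k : ℕ) (π : ℕ → (Fin n → Bool) → Fin 4) (hπ : ∀ j, BlockLocal bl j (π j)) :
    ∀ m ≤ k, ∃ T : ℕ → ZMod 3 → Fin 4, ∃ π' : ℕ → (Fin n → Bool) → Fin 4,
      (∀ j, BlockLocal bl j (π' j)) ∧ (∀ j < m, ∀ u, π' j u = T j (cl bl j u)) ∧
      (loses bl k π').card ≤ (loses bl k π).card := by
  intro m
  induction m with
  | zero => intro _; exact ⟨fun _ _ => 0, π, hπ, fun j hj => absurd hj (Nat.not_lt_zero j), le_rfl⟩
  | succ m ih =>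
    intro hm
    obtain ⟨T, π', hπ', htab, hle⟩ := ih (Nat.le_of_succ_le hm)
    obtain ⟨Tm, hle', hloc'⟩ := derand_step k π' hπ' m (Nat.lt_of_succ_le hm)
    refine ⟨Function.update T m Tm, Function.update π' m (fun u => Tm (cl bl m u)), hloc', ?_, hle'.trans hle⟩
    intro j hj u
    by_cases hjm : j = m
    · subst hjm; simp
    · have hj' : j < m := by omega
      rw [Function.update_of_ne hjm, Function.update_of_ne hjm, htab j hj' u]

/-- The LOSE set of a profile of class-tables is a union of CELLS. -/
theorem card_loses_tables (k : ℕ) (T : ℕ → ZMod 3 → Fin 4) (π : ℕ → (Fin n → Bool) → Fin 4)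
    (hT : ∀ j < k, ∀ u, π j u = T j (cl bl j u)) :
    (loses bl k π).card = ∑ w ∈ (univ.filter fun w : Fin k → ZMod 3 =>
        tabWin w (fun j => T j.val (w j)) = false), (univ.filter fun u => cvec bl k u = w).card := by
  classical
  rw [card_eq_sum_card_fiberwise (f := fun u => cvec bl k u) (t := univ) (fun _ _ => mem_univ _)]
  rw [← Finset.sum_filter_add_sum_filter_not univ (fun w : Fin k → ZMod 3 =>
    tabWin w (fun j => T j.val (w j)) = false)]
  conv_rhs => rw [← add_zero (∑ w ∈ _, _)]
  congr 1
  · refine Finset.sum_congr rfl fun w hw => ?_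
    congr 1; ext u
    simp only [loses, mem_filter, mem_univ, true_and, and_iff_right_iff_imp]
    intro hu
    have : (fun j : Fin k => π j.val u) = fun j => T j.val (w j) := by
      funext j; rw [hT j.val j.isLt u, ← hu]; rfl
    rw [this, hu]; exact (mem_filter.1 hw).2
  · refine Finset.sum_eq_zero fun w hw => ?_
    rw [Finset.card_eq_zero, Finset.filter_eq_empty_iff]
    intro u hu huw
    have hl := (mem_filter.1 hu).2
    have : (fun j : Fin k => π j.val u) = fun j => T j.val (w j) := by
      funext j; rw [hT j.val j.isLt u, ← huw]; rfl
    rw [this, huw] at hl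
    exact (mem_filter.1 hw).2 hl

/-- the number of failing cells of a table profile is `3^k − nWins`. -/
theorem card_fail_cells (k : ℕ) (T : ℕ → ZMod 3 → Fin 4) :
    (univ.filter fun w : Fin k → ZMod 3 => tabWin w (fun j => T j.val (w j)) = false).card =
      3 ^ k - nWins (fun j : Fin k => T j.val) := by
  unfold nWins
  dsimp only
  have h := Finset.card_filter_add_card_filter_not (s := (univ : Finset (Fin k → ZMod 3)))
    (fun w : Fin k → ZMod 3 => tabWin w (fun j => T j.val (w j)) = true)
  simp only [card_univ, Fintype.card_fun, ZMod.card, Fintype.card_fin] at h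
  have h2 : (univ.filter fun w : Fin k → ZMod 3 => ¬ tabWin w (fun j => T j.val (w j)) = true) =
      (univ.filter fun w : Fin k → ZMod 3 => tabWin w (fun j => T j.val (w j)) = false) := by
    congr 1; ext w; simp
  rw [h2] at h
  omega

/-- **Cells are large**: if each class of each of the first `k` blocks has `≥ γ_j·2ⁿ` members, every
cell has `≥ (Π_{j<k} γ_j)·2ⁿ` members (independence count, block by block). -/
theorem cell_ge (k : ℕ) (γ : ℕ → ℝ) (hγ0 : ∀ j < k, 0 ≤ γ j)
    (hγ : ∀ j < k, ∀ r : ZMod 3, γ j * (2 : ℝ) ^ n ≤ ((univ.filter fun u : Fin n → Bool => cl bl j u = r).card : ℝ))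
    (w : Fin k → ZMod 3) :
    (∏ j ∈ range k, γ j) * (2 : ℝ) ^ n ≤ ((univ.filter fun u => cvec bl k u = w).card : ℝ) := by
  classical
  -- N_m := #{u : ∀ j < m, cl_j u = w_j}
  have key : ∀ m, m ≤ k → (∏ j ∈ range m, γ j) * (2 : ℝ) ^ n ≤
      ((univ.filter fun u : Fin n → Bool => ∀ j : Fin k, j.val < m → cl bl j.val u = w j).card : ℝ) := by
    intro m
    induction m with
    | zero =>
      intro _
      have hall : (univ.filter fun u : Fin n → Bool => ∀ j : Fin k, j.val < 0 → cl bl j.val u = w j) = univ :=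
        filter_true_of_mem fun u _ j hj => absurd hj (Nat.not_lt_zero _)
      rw [prod_range_zero, one_mul, hall, card_univ, Fintype.card_fun, Fintype.card_bool, Fintype.card_fin]
      push_cast; exact le_rfl
    | succ m ih =>
      intro hm
      have hmk : m < k := Nat.lt_of_succ_le hm
      have ih' := ih (Nat.le_of_succ_le hm)
      -- split: (∀ j < m+1) = (cl_m = w_m) ∧ (∀ j < m)
      have hsplit : (univ.filter fun u : Fin n → Bool => ∀ j : Fin k, j.val < m + 1 → cl bl j.val u = w j) =
          (univ.filter fun u : Fin n → Bool => cl bl m u = w ⟨m, hmk⟩ ∧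
            ∀ j : Fin k, j.val < m → cl bl j.val u = w j) := by
        congr 1; ext u
        constructor
        · intro h; exact ⟨h ⟨m, hmk⟩ (Nat.lt_succ_self m), fun j hj => h j (Nat.lt_succ_of_lt hj)⟩
        · rintro ⟨h1, h2⟩ j hj
          rcases Nat.lt_succ_iff_lt_or_eq.1 hj with hj' | hj'
          · exact h2 j hj'
          · have : j = ⟨m, hmk⟩ := Fin.ext hj'
            subst this; exact h1
      rw [hsplit, indep_count_real m (fun u => cl bl m u = w ⟨m, hmk⟩)
        (fun u => ∀ j : Fin k, j.val < m → cl bl j.val u = w j)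
        (fun u v huv => by rw [blockLocal_cl m u v huv])
        (fun u a => by
          constructor
          · intro h j hj; have := h j hj; rwa [cl_ovr_ne (by omega : m ≠ j.val)] at this
          · intro h j hj; rw [cl_ovr_ne (by omega : m ≠ j.val)]; exact h j hj)]
      have hcl := hγ m hmk (w ⟨m, hmk⟩)
      have h2n : (0 : ℝ) < 2 ^ n := by positivity
      rw [prod_range_succ]
      rw [le_div_iff₀ h2n]
      have hprod0 : 0 ≤ ∏ j ∈ range m, γ j := Finset.prod_nonneg fun j hj => hγ0 j ((mem_range.1 hj).trans hmk)
      calc (∏ j ∈ range m, γ j) * γ m * 2 ^ n * 2 ^ n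
          = (γ m * 2 ^ n) * ((∏ j ∈ range m, γ j) * 2 ^ n) := by ring
        _ ≤ ((univ.filter fun u : Fin n → Bool => cl bl m u = w ⟨m, hmk⟩).card : ℝ) *
              ((univ.filter fun u : Fin n → Bool => ∀ j : Fin k, j.val < m → cl bl j.val u = w j).card : ℝ) :=
            mul_le_mul hcl ih' (mul_nonneg hprod0 h2n.le) (Nat.cast_nonneg _)
  have hfin := key k le_rfl
  have hset : (univ.filter fun u : Fin n → Bool => ∀ j : Fin k, j.val < k → cl bl j.val u = w j) =
      (univ.filter fun u => cvec bl k u = w) := by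
    congr 1; ext u
    simp only [cvec, funext_iff]
    exact ⟨fun h j => h j j.isLt, fun h j _ => h j⟩
  rw [hset] at hfin
  exact hfin

/-- **The pattern law.** If every profile of class-tables wins at most `N` of the `3^k` cells, then every
block-local pattern family loses on at least `(3^k − N)·(Π_{j<k} γ_j)·2ⁿ` inputs. -/
theorem pattern_law (k N : ℕ) (hN : ∀ t : Fin k → ZMod 3 → Fin 4, nWins t ≤ N)
    (π : ℕ → (Fin n → Bool) → Fin 4) (hπ : ∀ j, BlockLocal bl j (π j))
    (γ : ℕ → ℝ) (hγ0 : ∀ j < k, 0 ≤ γ j)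
    (hγ : ∀ j < k, ∀ r : ZMod 3, γ j * (2 : ℝ) ^ n ≤ ((univ.filter fun u : Fin n → Bool => cl bl j u = r).card : ℝ)) :
    ((3 : ℝ) ^ k - N) * (∏ j ∈ range k, γ j) * (2 : ℝ) ^ n ≤ ((loses bl k π).card : ℝ) := by
  classical
  obtain ⟨T, π', -, htab, hle⟩ := derand k π hπ k le_rfl
  have hcells := card_loses_tables k T π' htab
  have hfail := card_fail_cells k T
  have hNk := hN (fun j : Fin k => T j.val)
  have hprod0 : 0 ≤ (∏ j ∈ range k, γ j) * (2 : ℝ) ^ n :=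
    mul_nonneg (Finset.prod_nonneg fun j hj => hγ0 j (mem_range.1 hj)) (by positivity)
  by_cases hkN : (N : ℝ) ≤ (3 : ℝ) ^ k
  swap
  · have hneg : ((3 : ℝ) ^ k - N) ≤ 0 := by linarith [lt_of_not_ge hkN]
    calc ((3 : ℝ) ^ k - N) * (∏ j ∈ range k, γ j) * (2 : ℝ) ^ n ≤ 0 := by nlinarith [hprod0, hneg]
      _ ≤ ((loses bl k π).card : ℝ) := Nat.cast_nonneg _
  have hNle : N ≤ 3 ^ k := by exact_mod_cast hkN
  calc ((3 : ℝ) ^ k - N) * (∏ j ∈ range k, γ j) * (2 : ℝ) ^ n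
      ≤ ((3 ^ k - nWins (fun j : Fin k => T j.val) : ℕ) : ℝ) * ((∏ j ∈ range k, γ j) * (2 : ℝ) ^ n) := by
        rw [mul_assoc]
        refine mul_le_mul_of_nonneg_right ?_ hprod0
        rw [Nat.cast_sub ((hNk.trans hNle))]
        push_cast
        have : (nWins (fun j : Fin k => T j.val) : ℝ) ≤ N := by exact_mod_cast hNk
        linarith
    _ ≤ ∑ w ∈ (univ.filter fun w : Fin k → ZMod 3 => tabWin w (fun j => T j.val (w j)) = false),
          ((univ.filter fun u => cvec bl k u = w).card : ℝ) := by
        rw [← hfail]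
        calc (((univ.filter fun w : Fin k → ZMod 3 => tabWin w (fun j => T j.val (w j)) = false).card : ℕ) : ℝ) *
              ((∏ j ∈ range k, γ j) * (2 : ℝ) ^ n)
            = ∑ w ∈ (univ.filter fun w : Fin k → ZMod 3 => tabWin w (fun j => T j.val (w j)) = false),
                (∏ j ∈ range k, γ j) * (2 : ℝ) ^ n := by rw [sum_const, nsmul_eq_mul]
          _ ≤ _ := Finset.sum_le_sum fun w _ => cell_ge k γ hγ0 hγ w
    _ = ((loses bl k π').card : ℝ) := by rw [hcells]; push_cast; rfl
    _ ≤ ((loses bl k π).card : ℝ) := by exact_mod_cast hle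

end Bridge

end Summit.QuantumAdvantage.QuantumAdvantage.Theorems.PartyDial
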